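import Summits.BirchSwinnertonDyer.BirchSwinnertonDyer.Theorems.SignedBaseChangeAnticyclotomicEisensteinDivisibilityAdmdefKolyvaginRoot
import Summits.BirchSwinnertonDyer.BirchSwinnertonDyer.Theorems.SignedBaseChangeAnticyclotomicEisensteinDivisibilityAdmdefSignedControl
import HarnessLib

/-!
# Line `admdef` (crux `AnticyclotomicEisensteinDivisibility`, stmt-BirchSwinnertonDyer-20727), rigidity road: KOLYVAGIN'S THEOREM modulo `𝔪`
# AT EVERY INDEFINITE VERTEX — `κ_1(n)_0 ≠ 0 ⟹ Sel^ε_n(K_0, E[p]) = ℤ·κ_1(n)_0` for `n ∈ 𝒩_1^ind` (a vertex where the class is visible is a CORE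
# vertex and the class generates its stub: [Howard2006] Thm. 3.2.3 (c), one direction, at every indefinite vertex)

LEAD seat bsd-line-sbc-p1 (gen 31), `--supports stmt-BirchSwinnertonDyer-20727` (helper; OFF the v23 composition path).  The sibling
`…AdmdefKolyvaginRoot` proves the statement at the root `n = 1`; the SAME proof runs at every indefinite vertex `n` once Čebotarev is asked to
avoid the primes of `n`:

* §1 `exists_admissibleFrob_resOfLe_ne_zero_notMem` — `…AdmdefRootZero.exists_admissibleFrob_resOfLe_ne_zero` WITH AN EXCLUSION SET `B₁`: every
  non-zero `x ∈ H¹(Γ_{K_0}, E[p])` is visible (`res_{⟨φ⟩} x ≠ 0`) at an arithmetic Frobenius `φ ∈ D_𝔓 ∩ Gal(K̄/K_∞)` over a `1`-admissible `q ∉ B₁`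
  (same proof; the exclusion joins the ramification and bad places fed to `…RootZero.exists_admissible_torsionLocMap_ne_zero`).
* §2 `mul_mem_defProducts_of_mem_indefProducts` — `n ∈ 𝒩_1^ind`, `q` admissible, `q ∤ n` ⟹ `nq ∈ 𝒩_1^def`.
* §3 ★★ `eq_zsmul_kappa_of_mem_signedOrdSelmerTorsion` — **KOLYVAGIN AT THE VERTEX `n`**: frame (`p ≥ 5`, `ρ̄_{E,p}` onto, `K` imaginary quadratic,
  Heegner, `p` split, `κ` anticyclotomic) + (CTRL) + (RAM) verbatim as in `…AdmdefHowardVanishing`; for `n ∈ 𝒩_1^ind`: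
  **`κ_1(n)_0 ≠ 0 ⟹ ∀ c ∈ Sel^ε_n(K_0, E[p]), ∃ a : ℤ, c = a • κ_1(n)_0`**.  Proof = the root proof with §1 (`B₁ = n.primeFactors`): second law at the
  edge `n — nq` read upwards (`λ_1(nq)(0) ∈ ℤ_pˣ`), §1 of the sibling (`loc_v X ≠ 0`; locally trivial ⟹ ordinary at every `𝔓' ∣ v`), the Kummer line at
  `v` (both lifts are unramified at `v ∤ n·p`, Gross (7.1)), transfer UP along `n ∣ nq`, Howard's vanishing lemma at the definite vertex `nq`.
  Also `hasUnitLambda_of_kappa_ne_zero` ([NV] ⟸ `κ_1(n)_0 ≠ 0` at any indefinite vertex, frame only).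
* §4 the all-ramified cell modulo the named print fact {Hatley–Lei–Vigni 2022 Lemma 3.7, local form}:
  `eq_zsmul_kappa_of_mem_signedOrdSelmerTorsion_of_lemma37_local`.

So after this file Howard's rigidity for CHKLL25's signed bipartite systems mod `𝔪` reads, in kernel (modulo (CTRL)/(RAM), resp. one named fact on
the all-ramified cell): at EVERY indefinite vertex `n`, «`κ_1(n)_0 ≠ 0` ⟹ `n` is a core vertex whose bottom signed Selmer group is the line
`ℤ·κ_1(n)_0`, and [NV] holds»; at the ROOT also the converse given [NV] (`…AdmdefHowardRootEquivalence`).  NOT proved: the converse at `n ≠ 1`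
(rank RAISING along the graph needs the existence half of Poitou–Tate), hence not Howard's Thm. 3.2.3 (b) «[NV] ⟹ κ_n ≠ 0 at every core vertex».

HONEST FRAMING: theorems only (no definition, no named fact, no `sorry`); (CTRL)/(RAM) resp. the named fact and binder (ii) are HYPOTHESES; nothing
about the crux, the anchors (K1) or BSD is asserted; no summit statement is proved.

References: [cite: Howard2006, Thm. 2.3.7, Lem. 2.3.3–2.3.4, Thm. 3.2.3] [cite: BertoliniDarmon2005, Lemma 2.6, Thm. 3.2, proof of Thm. 4.1]
[cite: WZhang2014, Prop. 5.4, Lemma 7.3, §9 (9.2)] [cite: CastellaEtAl2025, Thm. 7.4, Thm. 7.5, §7.2 (arXiv:2308.10474v2 pp. 29–31)]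
[cite: GrossLMS1991, §7 (7.1), Prop. 9.6] [cite: HatleyLeiVigni2022, Lemma 3.7] [cite: Washington1997, Prop. 13.2].
-/

-- D-0017: single-problem summit, the namespace repeats the problem name by design.
set_option linter.dupNamespace false
set_option autoImplicit false

noncomputable section

open scoped Classical NumberField Pointwise

namespace Summit.BirchSwinnertonDyer.BirchSwinnertonDyer.Theorems.SignedBaseChangeAcDivAdmdefKolyvaginVertex

open CategoryTheory WeierstrassCurve NumberField IsDedekindDomain Field Module
open Literature.NumberTheory.EllipticCurves Literature.NumberTheory.GaloisRepresentations
open Literature.NumberTheory.EllipticCurves.CastellaHsuKunduLeeLiu2025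
open Literature.NumberTheory.EllipticCurves.BertoliniDarmon2005
open Literature.NumberTheory.EllipticCurves.AcSigned
open Summit.BirchSwinnertonDyer.BirchSwinnertonDyer.Theorems
open Summit.BirchSwinnertonDyer.BirchSwinnertonDyer.Theorems.AdditiveKoly
open Summit.BirchSwinnertonDyer.Rank1Residual.X11b.Three.Koly.Method2
open Summit.BirchSwinnertonDyer.BirchSwinnertonDyer.Theorems.SignedBaseChangeAcDivAdmdefCoreRootOfSeenAnchor
open Summit.BirchSwinnertonDyer.BirchSwinnertonDyer.Theorems.SignedBaseChangeAcDivAdmdefRootZero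
open Summit.BirchSwinnertonDyer.BirchSwinnertonDyer.Theorems.SignedBaseChangeAcDivAdmdefUnitLambdaOfLoc
open Summit.BirchSwinnertonDyer.BirchSwinnertonDyer.Theorems.SignedBaseChangeAcDivAdmdefSelmerBookkeeping
open Summit.BirchSwinnertonDyer.BirchSwinnertonDyer.Theorems.SignedBaseChangeAcDivAdmdefLayerZeroDictionary
open Summit.BirchSwinnertonDyer.BirchSwinnertonDyer.Theorems.SignedBaseChangeAcDivAdmdefHowardVanishing
open Summit.BirchSwinnertonDyer.BirchSwinnertonDyer.Theorems.SignedBaseChangeAcDivAdmdefRamifiedBaseChange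
open Summit.BirchSwinnertonDyer.BirchSwinnertonDyer.Theorems.SignedBaseChangeAcDivAdmdefSignedControl
open Summit.BirchSwinnertonDyer.BirchSwinnertonDyer.Theorems.SignedBaseChangeAcDivAdmdefKolyvaginRoot
open scoped ContRepresentation

universe u

/-! ## §1 Čebotarev with the sign at a Frobenius of `Gal(K̄/K_∞)`, AVOIDING a finite set of primes -/

section Cebotarev

/-- The rational prime below a place `v ∋ q` is `q` (`= absNorm (v ∩ ℤ)`). [folklore] -/
private theorem eq_absNorm_under_of_natCast_mem {K : Type} [Field K] [NumberField K] (v : HeightOneSpectrum (𝓞 K)) {q : ℕ} (hq : q.Prime)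
    (hqv : (q : 𝓞 K) ∈ v.asIdeal) : q = Ideal.absNorm (v.asIdeal.under ℤ) := by
  -- adapted from Theorems/…AdmdefRootZero.lean (private brick)
  haveI : NeZero v.asIdeal := ⟨v.ne_bot⟩
  have hdvd : Ideal.absNorm (v.asIdeal.under ℤ) ∣ q :=
    Int.natCast_dvd_natCast.1 (Int.cast_mem_ideal_iff.1 (by simpa using hqv))
  exact ((Nat.prime_dvd_prime_iff_eq (Nat.absNorm_under_prime v.asIdeal) hq).1 hdvd).symm

/-- A place containing an inert rational prime `q` IS `(q)`. [folklore] -/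
private theorem asIdeal_eq_span_of_mem {K : Type} [Field K] [NumberField K] {q : ℕ} (hq0 : q ≠ 0) (hqP : (Ideal.span {((q : ℕ) : 𝓞 K)}).IsPrime)
    (v : HeightOneSpectrum (𝓞 K)) (hqv : (q : 𝓞 K) ∈ v.asIdeal) : v.asIdeal = Ideal.span {((q : ℕ) : 𝓞 K)} := by
  -- adapted from Theorems/…AdmdefRootZero.lean (private brick)
  have hbot : Ideal.span {((q : ℕ) : 𝓞 K)} ≠ ⊥ := by
    rw [Ne, Ideal.span_singleton_eq_bot]; exact_mod_cast hq0
  exact ((hqP.isMaximal hbot).eq_of_le v.isPrime.ne_top ((Ideal.span_singleton_le_iff_mem _).mpr hqv)).symm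

variable {K : Type} [Field K] [NumberField K] {W : WeierstrassCurve ℚ} [W.IsElliptic] [W.IsGloballyMinimal] {p : ℕ} [Fact p.Prime]

/-- **A non-zero class of `H¹(K_0, E[p])` is visible at an admissible Frobenius of `Gal(K̄/K_∞)` over a prime OUTSIDE any given finite set** —
`…AdmdefRootZero.exists_admissibleFrob_resOfLe_ne_zero` with an exclusion set `B₁ : Finset ℕ` (the primes of a level `n`, typically).  Frame: `p ≥ 5`,
`ρ̄_{E,p}` onto, `K` imaginary quadratic, `N_E` Heegner, `p` split, `κ` anticyclotomic.  Same proof: Čebotarev with the sign outside `B₁ ∪` {ramification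
places of a lift, bad places}; the Frobenius lies in `ker κ` since the inert `(q)` splits completely in `K_∞`; Gross's criterion at a non-trivial Frobenius.
[cite: WZhang2014, Lemma 7.3, §9 (9.2)] [cite: BertoliniDarmon2005, Thm. 3.2] [cite: GrossLMS1991, Prop. 9.6] [cite: Washington1997, Prop. 13.2] -/
theorem exists_admissibleFrob_resOfLe_ne_zero_notMem (h5 : 5 ≤ p) (hsurj : W.HasSurjectiveModNGaloisRep p)
    (hK : IsImaginaryQuadratic K) (hH : SatisfiesHeegnerHypothesis (W.conductorNorm ℤ) K)
    (hsp : ((Ideal.span {(p : ℤ)}).primesOver (𝓞 K)).ncard = 2) (κ : ZpExtension K p) (hκ : κ.IsAnticyclotomic)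
    (x : (W.baseChange K).torsionH1Over ((p : ℤ) ^ 1) (κ.layerSubgroup 0)) (hx : x ≠ 0) (B₁ : Finset ℕ) :
    ∃ q : ℕ, q ∉ B₁ ∧ IsAdmissiblePrime (W.conductorNorm ℤ) K (fun ℓ ↦ W.frobeniusTrace ℓ) p 1 q ∧
      ∃ v : HeightOneSpectrum (𝓞 K), ((q : ℕ) : 𝓞 K) ∈ v.asIdeal ∧ ∃ 𝔓 ∈ v.primesAbove,
        ∃ (φ : absoluteGaloisGroup K) (hφ : φ ∈ κ.kerSubgroup),
          φ ∈ 𝔓.decompositionSubgroup (absoluteGaloisGroup K) ∧ IsArithFrobAt (𝓞 K) φ 𝔓 ∧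
          resOfLe (geomTorsion (W.baseChange K) ((p : ℤ) ^ 1))
            ((Subgroup.zpowers_le.mpr hφ).trans (κ.kerSubgroup_le_layerSubgroup 0)) x ≠ 0 := by
  -- adapted from Theorems/…AdmdefRootZero.lean `exists_admissibleFrob_resOfLe_ne_zero` (exclusion set `B₁` added to `B₀`)
  have hp : p.Prime := Fact.out
  set M := geomTorsion (W.baseChange K) ((p : ℤ) ^ 1) with hM
  obtain ⟨b, hb⟩ := oneCocycleClass_surjective (discreteTopRep (κ.layerSubgroup 0) M) x
  let ι : absoluteGaloisGroup K →ₜ* κ.layerSubgroup 0 :=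
    { toFun := fun g ↦ ⟨g, mem_layerSubgroup_zero κ g⟩
      map_one' := rfl
      map_mul' := fun _ _ ↦ rfl
      continuous_toFun := continuous_id.subtype_mk _ }
  have hιc : ∀ (g : absoluteGaloisGroup K) (m : M), AddMonoidHom.id M (ι g • m) = g • AddMonoidHom.id M m := fun _ _ ↦ rfl
  set ψ : contOneCocycles (discreteTopRep (absoluteGaloisGroup K) M) :=
    contOneCocycles.pullback ι (resHomOfEquivariant ι (AddMonoidHom.id M) hιc) b with hψdef
  have hψ : ∀ g : absoluteGaloisGroup K, ψ.1 g = b.1 (ι g) := fun g ↦ rfl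
  set X : Vp W K p := oneCocycleClass _ ψ with hXdef
  have hX : X ≠ 0 := by
    intro h0
    obtain ⟨a, ha⟩ := (oneCocycleClass_eq_zero_iff _ ψ).mp h0
    apply hx
    rw [← hb, oneCocycleClass_eq_zero_iff]
    refine ⟨a, fun s ↦ ?_⟩
    have hs : s = ι (s : absoluteGaloisGroup K) := Subtype.ext rfl
    have := ha (s : absoluteGaloisGroup K)
    rw [hψ, ← hs, discreteTopRep_ρ_apply] at this
    rw [discreteTopRep_ρ_apply]
    exact this
  -- the finite exceptional set: ramification places of `X`, bad places, and `B₁`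
  have hn0 : ((p ^ 1 : ℕ) : ℤ) ≠ 0 := by exact_mod_cast (pow_pos hp.pos 1).ne'
  obtain ⟨Tx, hTxfin, hTx⟩ := exists_finite_forall_mem_unramifiedKer (W.baseChange K) (n := ((p ^ 1 : ℕ) : ℤ)) hn0 X
  have hbad : ((W.baseChange K).badPlaces (𝓞 K)).Finite := (W.baseChange K).finite_badPlaces_holds (𝓞 K)
  set B₀ : Finset ℕ := (hTxfin.union hbad).toFinset.image (fun w : HeightOneSpectrum (𝓞 K) ↦ Ideal.absNorm (w.asIdeal.under ℤ)) ∪ B₁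
    with hB₀
  obtain ⟨q, hqB, hadm, v, hqv, hloc⟩ := exists_admissible_torsionLocMap_ne_zero W K p h5 hsurj hK hH hsp X hX B₀
  have hq : q.Prime := hadm.1
  have hqB₁ : q ∉ B₁ := fun h ↦ hqB (by rw [hB₀]; exact Finset.mem_union_right _ h)
  have hvTB : v ∉ Tx ∪ (W.baseChange K).badPlaces (𝓞 K) := by
    intro hv
    apply hqB
    rw [hB₀, Finset.mem_union, Finset.mem_image]
    exact Or.inl ⟨v, (hTxfin.union hbad).mem_toFinset.mpr hv, (eq_absNorm_under_of_natCast_mem v hq hqv).symm⟩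
  have hvT : v ∉ Tx := fun h ↦ hvTB (Or.inl h)
  have hvbad : v ∉ (W.baseChange K).badPlaces (𝓞 K) := fun h ↦ hvTB (Or.inr h)
  have hqp : q ≠ p := by
    intro h
    exact hadm.2.1 (h ▸ dvd_mul_right q _)
  have hpv : ((p : ℕ) : 𝓞 K) ∉ v.asIdeal := not_natCast_mem_of_prime_ne hq hp hqp v hqv
  have hpv' : ((((p ^ 1 : ℕ) : ℤ)) : 𝓞 K) ∉ v.asIdeal := by
    rw [Int.cast_natCast, Nat.pow_one]; exact hpv
  haveI : CharZero (v.adicCompletion K) :=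
    charZero_of_injective_algebraMap (algebraMap K (v.adicCompletion K)).injective
  obtain ⟨𝔐, h𝔐⟩ := v.localPrimesAbove_nonempty
  set 𝔓 := v.primeBelow (closureEmb (K := K) (v.adicCompletion K)) 𝔐 with h𝔓def
  have h𝔓 : 𝔓 ∈ v.primesAbove := v.primeBelow_mem_primesAbove h𝔐
  haveI : 𝔓.IsPrime := h𝔓.1
  obtain ⟨F, hF⟩ := HeightOneSpectrum.exists_isArithFrobAt_of_mem_primesAbove_holds h𝔓
  have hFD : F ∈ 𝔓.decompositionSubgroup (absoluteGaloisGroup K) := hF.mem_stabilizer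
  have hspan : v.asIdeal = Ideal.span {((q : ℕ) : 𝓞 K)} := asIdeal_eq_span_of_mem hq.ne_zero hadm.2.2.1 v hqv
  have hFker : F ∈ κ.kerSubgroup := by
    rw [ZpExtension.mem_kerSubgroup, κ.apply_eq_frobExponentAt_of_isArithFrobAt hpv h𝔓 hF,
      κ.frobExponentAt_eq_zero_of_span_natCast hK hκ hpv hspan, ofAdd_zero]
  have hI : 𝔓.inertia (absoluteGaloisGroup K) ≤ torsionFixing (W.baseChange K) ((p ^ 1 : ℕ) : ℤ) :=
    inertia_le_torsionFixing (W.baseChange K) hvbad hpv' _ h𝔐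
  have hψI : ∀ i ∈ 𝔓.inertia (absoluteGaloisGroup K), ψ.1 i = 0 := by
    have hx' : oneCocycleClass _ ψ ∈ unramifiedKer (geomTorsion (W.baseChange K) ((p ^ 1 : ℕ) : ℤ)) 𝔓 := hTx v hvT 𝔓 h𝔓
    obtain ⟨a, ha⟩ := (oneCocycleClass_mem_subgroupResKer_iff _ ψ).mp hx'
    intro i hi
    rw [ha ⟨i, hi⟩]
    exact sub_eq_zero.mpr (smul_eq_of_mem_torsionFixing (W.baseChange K) _ (hI hi) a)
  refine ⟨q, hqB₁, hadm, v, hqv, 𝔓, h𝔓, F, hFker, hFD, hF, fun hres ↦ hloc ?_⟩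
  rw [← hb] at hres
  obtain ⟨a, ha⟩ := (CocycleCriteria.resOfLe_oneCocycleClass_eq_zero_iff _ b).mp hres
  have hbF : ψ.1 F = F • a - a := by
    have h := ha ⟨F, Subgroup.mem_zpowers F⟩
    have hincl : (Subgroup.inclusion ((Subgroup.zpowers_le.mpr hFker).trans (κ.kerSubgroup_le_layerSubgroup 0))
        ⟨F, Subgroup.mem_zpowers F⟩ : κ.layerSubgroup 0) = ι F := Subtype.ext rfl
    rw [hincl] at h
    rw [hψ]
    exact h
  have hcrit := LocalFrob.oneCocycleClass_mem_torsionLocalKer_iff_apply_frob (W.baseChange K) (n := p ^ 1)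
    (pow_pos hp.pos 1).ne' h𝔐 hF hI ψ hψI
  exact hcrit.mpr ⟨a, hbF⟩

end Cebotarev

/-! ## §2 `n ∈ 𝒩_1^ind`, `q` admissible, `q ∤ n` ⟹ `nq ∈ 𝒩_1^def` -/

section Products

variable {K : Type} [Field K] {N : ℕ} {a : ℕ → ℤ} {p : ℕ}

/-- `n · q ∈ 𝒩_1^def` for `n ∈ 𝒩_1^ind` and a `1`-admissible prime `q ∤ n` (square-free, admissible prime factors, ONE MORE of them: even ⟶ odd).
[cite: Howard2006, Def. 3.2.1] [cite: CastellaEtAl2025, §7.2 (arXiv:2308.10474v2 p0030 L1–L6)] -/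
theorem mul_mem_defProducts_of_mem_indefProducts {n q : ℕ} (hn : n ∈ indefProducts N K a p 1)
    (hq : IsAdmissiblePrime N K a p 1 q) (hqn : ¬ q ∣ n) : n * q ∈ defProducts N K a p 1 := by
  -- adapted from Theorems/…AdmdefHowardVanishing.lean `mul_mem_indefProducts_of_mem_defProducts` (parity flipped)
  have hqp : q.Prime := hq.prime
  have hcop : Nat.Coprime n q := Nat.coprime_comm.mp ((Nat.Prime.coprime_iff_not_dvd hqp).mpr hqn)
  refine ⟨⟨Nat.squarefree_mul_iff.mpr ⟨hcop, hn.1.1, hqp.squarefree⟩, fun ℓ hℓ hℓnq ↦ ?_⟩, ?_⟩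
  · rcases (Nat.Prime.dvd_mul hℓ).mp hℓnq with h | h
    · exact hn.1.2 ℓ hℓ h
    · rwa [(Nat.prime_dvd_prime_iff_eq hℓ hqp).mp h]
  · rw [Nat.Coprime.primeFactors_mul hcop, hqp.primeFactors,
      Finset.card_union_of_disjoint (by rw [← hqp.primeFactors]; exact Nat.Coprime.disjoint_primeFactors hcop),
      Finset.card_singleton, Nat.odd_add_one]
    exact Nat.not_odd_iff_even.mpr hn.2

end Products

/-! ## §3 KOLYVAGIN'S THEOREM modulo `𝔪` at an indefinite vertex `n`, modulo (CTRL) and (RAM) -/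

section Kolyvagin

variable {K : Type} [Field K] [NumberField K] {W : WeierstrassCurve ℚ} [W.IsElliptic] [W.IsGloballyMinimal] {p : ℕ} [Fact p.Prime]
  {κ : ZpExtension K p} {γ : absoluteGaloisGroup K} {N : ℕ} {ε : ℤˣ} {B : SignedBipartiteSystem W K p κ}

/-- **KOLYVAGIN'S THEOREM modulo `𝔪` AT THE INDEFINITE VERTEX `n`** for a signed bipartite system `B` of sign `ε` at level `N = N_E`, on the frame
(`p ≥ 5`, `ρ̄_{E,p}` onto, `K` imaginary quadratic, `N_E` Heegner, `p` split, `κ` anticyclotomic), modulo (CTRL) and (RAM) exactly as in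
`…AdmdefHowardVanishing`: for `n ∈ 𝒩_1^ind`, if the bottom class `κ_1(n)_0 ∈ H¹(Γ_{K_0}, E[p])` is NON-ZERO then **every class of
`Sel^ε_n(K_0, E[p]) = signedOrdSelmerTorsion (E/K) p κ ε n 0 1` is an integer multiple of `κ_1(n)_0`** — `n` is a core vertex and `κ_1(n)_0`
generates its stub ([Howard2006] Thm. 3.2.3 (c) at `n`, one direction).  Proof: the root proof of the sibling file with Čebotarev avoiding the primes of
`n` (§1), the second law at the edge `n — nq`, the Kummer line at `v`, transfer UP along `n ∣ nq`, and Howard's vanishing lemma at `nq ∈ 𝒩_1^def`.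
[cite: Howard2006, Thm. 2.3.7, Lem. 2.3.3–2.3.4, Thm. 3.2.3 (c)] [cite: BertoliniDarmon2005, proof of Thm. 4.1] [cite: WZhang2014, Prop. 5.4]
[cite: CastellaEtAl2025, Thm. 7.4 (both laws), Thm. 7.5 (arXiv:2308.10474v2 pp. 30–31)] -/
theorem eq_zsmul_kappa_of_mem_signedOrdSelmerTorsion (hB : IsSignedBipartiteSystem W K p κ γ N ε B)
    (hN : (N : ℤ) = W.conductorNorm ℤ) (h5 : 5 ≤ p) (hsurj : W.HasSurjectiveModNGaloisRep p) (hK : IsImaginaryQuadratic K)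
    (hH : SatisfiesHeegnerHypothesis (W.conductorNorm ℤ) K) (hsp : ((Ideal.span {(p : ℤ)}).primesOver (𝓞 K)).ncard = 2)
    (hκ : κ.IsAnticyclotomic)
    (hctrl : ∀ v : HeightOneSpectrum (𝓞 K), ((p : ℕ) : 𝓞 K) ∈ v.asIdeal → ∀ X : Vp W K p,
      resH1Hom (Literature.NumberTheory.EllipticCurves.subgroupIncl (κ.layerSubgroup 0))
          (AddSubgroup.inclusion (geomTorsion_natCast_pow_one W (K := K) (p := p)).le) (fun _ _ ↦ rfl) X ∈
        condAboveTorsion (W.baseChange K) p κ v (.sgn ε) 0 1 →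
      X ∈ selmerLocalKer (W.baseChange K) (v.adicCompletion K) ((p ^ 1 : ℕ) : ℤ))
    (hram : ∀ v : HeightOneSpectrum (𝓞 K), ¬ (W.baseChange K).HasGoodReductionAt v → ((p : ℕ) : 𝓞 K) ∉ v.asIdeal →
      ∃ 𝔓 ∈ v.primesAbove, ∃ τ ∈ 𝔓.inertia (absoluteGaloisGroup K), ∃ P : geomTorsion (W.baseChange K) ((p ^ 1 : ℕ) : ℤ), τ • P ≠ P)
    {n : ℕ} (hn : n ∈ indefProducts N K (fun ℓ ↦ W.frobeniusTrace ℓ) p 1) (hz0 : B.kappa 1 n 0 ≠ 0) :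
    ∀ c ∈ signedOrdSelmerTorsion (W.baseChange K) p κ ε n 0 1, ∃ a : ℤ, c = a • B.kappa 1 n 0 := by
  -- adapted from the sibling Theorems/…AdmdefKolyvaginRoot.lean `eq_zsmul_kappa_one_of_mem_signedOrdSelmerTorsion_one` (vertex `1` ⟶ `n`)
  intro c hc
  have hp : p.Prime := Fact.out
  have hN' : N = W.conductorNorm ℤ := by exact_mod_cast hN
  have hzSel : B.kappa 1 n 0 ∈ signedOrdSelmerTorsion (W.baseChange K) p κ ε n 0 1 :=
    kappa_layer_mem_signedOrdSelmerTorsion hB one_pos hn 0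
  -- (1) lift `z = κ_1(n)_0` and `c` to `H¹(K, E[p])`
  obtain ⟨X, hX⟩ := exists_resH1Hom_layerZero_eq W κ (B.kappa 1 n 0)
  obtain ⟨Y, hY⟩ := exists_resH1Hom_layerZero_eq W κ c
  -- (2) Čebotarev with the sign AVOIDING the primes of `n`: an admissible Frobenius of `Gal(K̄/K_∞)` seeing `z`
  obtain ⟨q, hqB, hadmE, v, hqv, 𝔓, h𝔓, φ, hφ, hφD, hφF, hres⟩ :=
    exists_admissibleFrob_resOfLe_ne_zero_notMem h5 hsurj hK hH hsp κ hκ (B.kappa 1 n 0) hz0 n.primeFactors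
  have hadm : IsAdmissiblePrime N K (fun ℓ ↦ W.frobeniusTrace ℓ) p 1 q := by rw [hN']; exact hadmE
  have hq : q.Prime := hadmE.1
  have hqn : ¬ q ∣ n := fun h ↦ hqB (Nat.mem_primeFactors.mpr ⟨hq, h, hn.1.1.ne_zero⟩)
  have hmq : n * q ∈ defProducts N K (fun ℓ ↦ W.frobeniusTrace ℓ) p 1 := mul_mem_defProducts_of_mem_indefProducts hn hadm hqn
  -- (3) second law at the edge `n — nq`, read upwards: `λ_1(nq)(0) ∈ ℤ_pˣ`
  have hlam : IsUnit (PowerSeries.constantCoeff (B.lam 1 (n * q))) :=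
    isUnit_constantCoeff_lam_of_unrLoc_ne_zero hB hmq hadm hqn hqv h𝔓 hφ hφD hφF (a := 0) (by rwa [unrLoc_apply_zero])
  -- (4) `loc_v X ≠ 0` and both lifts are Kummer at the good place `v` (no prime of `n` lies under `v`)
  have hlocX : galoisCohomology.localization ((W.baseChange K).torsionGaloisModule ((p ^ 1 : ℕ) : ℤ)) (Sum.inr v) 1 X ≠ 0 := by
    refine localization_ne_zero_of_resOfLe_zpowers_ne_zero W κ X h𝔓 hφD
      ((Subgroup.zpowers_le.mpr hφ).trans (κ.kerSubgroup_le_layerSubgroup 0)) ?_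
    rw [hX]; exact hres
  obtain ⟨hgoodv, hpv⟩ := hasGoodReductionAt_of_isAdmissiblePrime W K hadmE v hqv
  have hpv' : ((p : ℕ) : 𝓞 K) ∉ v.asIdeal := by rw [← Int.cast_natCast]; exact hpv
  have h𝔓₀ := adicCompletionPrime_mem_primesAbove K v
  have huniq : ∀ w : HeightOneSpectrum (𝓞 K), ((q : ℕ) : 𝓞 K) ∈ w.asIdeal → w = v :=
    fun w hw ↦ placesAbove_eq_of_isPrime_span K hadmE.2.2.1 hq.ne_zero hqv hw
  have hnov : ¬ ∃ ℓ : ℕ, ℓ.Prime ∧ ℓ ∣ n ∧ ((ℓ : ℕ) : 𝓞 K) ∈ v.asIdeal := by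
    rintro ⟨ℓ, hℓ, hℓn, hℓv⟩
    have hne : q ≠ ℓ := fun h ↦ hqn (h ▸ hℓn)
    have h := not_mem_asIdeal_of_coprime K ((Nat.coprime_primes hq hℓ).mpr hne) v hqv
    exact h (by exact_mod_cast hℓv)
  have hXk : X ∈ selmerLocalKer (W.baseChange K) (v.adicCompletion K) ((p ^ 1 : ℕ) : ℤ) := by
    refine (resH1Hom_layerZero_mem_unramifiedAt_iff_mem_selmerLocalKer W κ hgoodv hpv' h𝔓₀ X).mp ?_
    rw [hX]
    exact ((mem_signedOrdSelmerTorsion_iff _).mp hzSel).2.2 v hpv' hnov _ h𝔓₀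
  have hYk : Y ∈ selmerLocalKer (W.baseChange K) (v.adicCompletion K) ((p ^ 1 : ℕ) : ℤ) := by
    refine (resH1Hom_layerZero_mem_unramifiedAt_iff_mem_selmerLocalKer W κ hgoodv hpv' h𝔓₀ Y).mp ?_
    rw [hY]
    exact ((mem_signedOrdSelmerTorsion_iff _).mp hc).2.2 v hpv' hnov _ h𝔓₀
  -- (5) the Kummer line at `v`: `loc_v (Y − a X) = 0`
  obtain ⟨a, ha⟩ := exists_zsmul_localization_sub_eq_zero_of_isAdmissiblePrime W hK hadmE hqv hXk hYk hlocX
  -- (6) `c − a z ∈ Sel^ε_{nq}(K_0, E[p])`: ordinary at every `𝔓' ∣ v`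
  have hTsub : resH1Hom (Literature.NumberTheory.EllipticCurves.subgroupIncl (κ.layerSubgroup 0))
      (AddSubgroup.inclusion (geomTorsion_natCast_pow_one W (K := K) (p := p)).le) (fun _ _ ↦ rfl) (Y - a • X) =
      c - a • B.kappa 1 n 0 := by
    rw [map_sub, map_zsmul, hY, hX]
  have hmem : c - a • B.kappa 1 n 0 ∈ signedOrdSelmerTorsion (W.baseChange K) p κ ε (n * q) 0 1 := by
    refine mem_signedOrdSelmerTorsion_of_dvd_of_forall_ordinaryAt (dvd_mul_right n q) (sub_mem hc (zsmul_mem hzSel a)) ?_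
    intro ℓ hℓ hℓnq hℓn w hpw hℓw 𝔓' h𝔓'
    have hℓq : ℓ = q := by
      rcases (Nat.Prime.dvd_mul hℓ).mp hℓnq with h | h
      · exact (hℓn h).elim
      · exact (Nat.prime_dvd_prime_iff_eq hℓ hq).mp h
    subst hℓq
    have hwv : w = v := huniq w hℓw
    subst hwv
    rw [← hTsub]
    exact forall_mem_ordinaryAt_of_localization_eq_zero W κ (Y - a • X) ha 𝔓' h𝔓'
  -- (7) Howard's vanishing lemma at the definite vertex `nq`
  have h0 := eq_zero_of_mem_signedOrdSelmerTorsion_of_isUnit_lam hB hN h5 hsurj hK hH hsp hκ hctrl hram hmq hlam _ hmem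
  exact ⟨a, (sub_eq_zero.mp h0)⟩

/-- **`κ_1(n)_0 ≠ 0` at an indefinite vertex `n` yields [NV]** (Čebotarev avoiding the primes of `n` ∘ second law at the edge `n — nq`:
`…AdmdefUnitLambdaOfLoc.hasUnitLambda_of_unrLoc_ne_zero`), on the frame alone (no (CTRL)/(RAM)).
[cite: CastellaEtAl2025, Thm. 7.4 second law, Thm. 7.5] [cite: Howard2006, Thm. 3.2.3 (c)] -/
theorem hasUnitLambda_of_kappa_ne_zero (hB : IsSignedBipartiteSystem W K p κ γ N ε B)
    (hN : (N : ℤ) = W.conductorNorm ℤ) (h5 : 5 ≤ p) (hsurj : W.HasSurjectiveModNGaloisRep p) (hK : IsImaginaryQuadratic K)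
    (hH : SatisfiesHeegnerHypothesis (W.conductorNorm ℤ) K) (hsp : ((Ideal.span {(p : ℤ)}).primesOver (𝓞 K)).ncard = 2)
    (hκ : κ.IsAnticyclotomic) {n : ℕ} (hn : n ∈ indefProducts N K (fun ℓ ↦ W.frobeniusTrace ℓ) p 1) (hz0 : B.kappa 1 n 0 ≠ 0) :
    B.HasUnitLambda N := by
  have hN' : N = W.conductorNorm ℤ := by exact_mod_cast hN
  obtain ⟨q, hqB, hadmE, v, hqv, 𝔓, h𝔓, φ, hφ, hφD, hφF, hres⟩ :=
    exists_admissibleFrob_resOfLe_ne_zero_notMem h5 hsurj hK hH hsp κ hκ (B.kappa 1 n 0) hz0 n.primeFactors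
  have hadm : IsAdmissiblePrime N K (fun ℓ ↦ W.frobeniusTrace ℓ) p 1 q := by rw [hN']; exact hadmE
  have hq : q.Prime := hadmE.1
  have hqn : ¬ q ∣ n := fun h ↦ hqB (Nat.mem_primeFactors.mpr ⟨hq, h, hn.1.1.ne_zero⟩)
  exact hasUnitLambda_of_unrLoc_ne_zero hB (mul_mem_defProducts_of_mem_indefProducts hn hadm hqn) hadm hqn hqv h𝔓 hφ hφD hφF
    (a := 0) (by rwa [unrLoc_apply_zero])

end Kolyvagin

/-! ## §4 The all-ramified cell, modulo HLV Lemma 3.7 (local form) -/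

section AllRamified

variable {K : Type} [Field K] [NumberField K] {W : WeierstrassCurve ℚ} [W.IsElliptic] [W.IsGloballyMinimal] {p : ℕ} [Fact p.Prime]
  {κ : ZpExtension K p} {γ : absoluteGaloisGroup K} {N : ℕ} {ε : ℤˣ} {B : SignedBipartiteSystem W K p κ} {𝔭 𝔭' : HeightOneSpectrum (𝓞 K)}

/-- **Kolyvagin at the indefinite vertex `n` on the all-ramified cell, modulo HLV Lemma 3.7 (local form)** — `AcSigned.Setting` + the named print
fact + `(N, d_K) = 1` + binder (ii) «`E[p]` ramified at every `q ∣ N`» + the frame; for `n ∈ 𝒩_1^ind`: `κ_1(n)_0 ≠ 0 ⟹` every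
`c ∈ Sel^ε_n(K_0, E[p])` is `a • κ_1(n)_0`.  ((CTRL) := `ctrl_of_lemma37_local`; (RAM) := `forall_exists_inertia_smul_ne_baseChange_of_allRamified`.)
[cite: Howard2006, Thm. 3.2.3 (c)] [cite: CastellaEtAl2025, Thm. 7.1 (ii), Thm. 7.5] [cite: HatleyLeiVigni2022, Lemma 3.7] -/
theorem eq_zsmul_kappa_of_mem_signedOrdSelmerTorsion_of_lemma37_local (hB : IsSignedBipartiteSystem W K p κ γ N ε B)
    (hS : Setting W K p κ 𝔭 𝔭') (hloc : hatleyLeiVigni2022_lemma37_local_signedCondition_eq_kummer W K p κ 𝔭 𝔭')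
    (hN : (N : ℤ) = W.conductorNorm ℤ) (h5 : 5 ≤ p) (hsurj : W.HasSurjectiveModNGaloisRep p)
    (hH : SatisfiesHeegnerHypothesis (W.conductorNorm ℤ) K) (hsp : ((Ideal.span {(p : ℤ)}).primesOver (𝓞 K)).ncard = 2)
    (hND : IsCoprime (N : ℤ) (NumberField.discr K))
    (hall : ∀ q : ℕ, q.Prime → q ∣ N → ∃ v' : HeightOneSpectrum (𝓞 ℚ), ((q : ℕ) : 𝓞 ℚ) ∈ v'.asIdeal ∧
      ∃ 𝔓 ∈ v'.primesAbove, ∃ σ ∈ 𝔓.inertia (absoluteGaloisGroup ℚ), ∃ P : W.geomTorsion (p : ℤ), σ • P ≠ P)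
    {n : ℕ} (hn : n ∈ indefProducts N K (fun ℓ ↦ W.frobeniusTrace ℓ) p 1) (hz0 : B.kappa 1 n 0 ≠ 0) :
    ∀ c ∈ signedOrdSelmerTorsion (W.baseChange K) p κ ε n 0 1, ∃ a : ℤ, c = a • B.kappa 1 n 0 :=
  eq_zsmul_kappa_of_mem_signedOrdSelmerTorsion hB hN h5 hsurj hS.isImaginaryQuadratic hH hsp hS.anticyclotomic
    (ctrl_of_lemma37_local W κ hS hH hloc ε)
    (forall_exists_inertia_smul_ne_baseChange_of_allRamified W hS.isImaginaryQuadratic.1 hN hND hall) hn hz0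

end AllRamified

end Summit.BirchSwinnertonDyer.BirchSwinnertonDyer.Theorems.SignedBaseChangeAcDivAdmdefKolyvaginVertex

end
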